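import Literature.NumberTheory.Transcendental.RoyCriterionProp2Proofs
import HarnessLib

/-!
# Depth at one point is free: the single-point part of Roy's condition (b) holds off the graph

Soloist seat `solo-Schanuel-informed` (session 4). Namespace `Summit.Schanuel.Schanuel.Theorems`.

Roy's Theorem 1 (Roy 2001, Thm. 1; in the tree `Roy2001_thm1_holds`): for `(y, α) ∈ ℂ × ℂˣ` and
parameters in window (1), condition (b) `RoyConditionB y α s₀ s₁ t₀ t₁ u` — for all large `N` some
non-zero `Q_N ∈ ℤ[X₀, X₁]`, `deg ≤ (N^{t₀}, N^{t₁})`, `H(Q_N) ≤ e^N`, has `|(D^k Q_N)(m y, α^m)| ≤ e^{-N^u}`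
for ALL `k ≤ N^{s₀}` (depth) and ALL `m ≤ N^{s₁}` (translates) — holds iff (a) `α^d = e^{dy}` for
some `d ≥ 1`. This file isolates which half of (b) carries the arithmetic: the DEPTH at one point
carries none. With the level-`N` SETS of polynomials (sets, so that no new propositions are
introduced under `Summits/`) `royBox t₀ t₁ N` (the box above), `roySmallOnTranslates y α s₀ s₁ u N`
(the evaluation condition of (b); `royConditionB_iff`), its single-point part `roySmallAt y α s₀ u N`
(`m = 1` only; `eventually_royBox_inter_roySmallAt_of_royConditionB`) and the exact form
`royVanishAt y α s₀ N` (`(D^k Q)(y, α) = 0` for all `k ≤ N^{s₀}`, no `u`), we prove for EVERY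
admissible `(s₀, s₁, t₀, t₁, u)`:

* `eventually_royBox_inter_royVanishAt_zero_inv` (`c ≠ 0`): at `(y, α) = (0, 1/c)` the box
  eventually meets `royVanishAt`. Construction: Siegel's lemma at level `N' = ⌊N/2⌋` gives `P̃ ≠ 0`,
  `H(P̃) ≤ e^{N'}`, whose first `⌊N'^λ⌋ + 1 > N^{s₀}` Taylor coefficients of `P̃(z, e^z)` at `0` vanish
  (`λ = royLambda t₀ t₁ u > s₀`; `exists_polyOfCoeffs_taylorInt_eq_zero`, the Siegel half of the
  tree's `exists_royAuxPoly`); `Q_N := P̃(X₀, c X₁)` has `(D^k Q_N)(0, 1/c) = (D^k P̃)(0, 1) = 0` because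
  `D = ∂₀ + X₁∂₁` commutes with `X₁ ↦ c X₁` (`royD_scaleX₁`), and `H(Q_N) ≤ |c|^{N^{t₁}} e^{N/2} ≤ e^N`
  since `t₁ < 1` in the window;
* hence `eventually_royBox_inter_roySmallAt_zero_inv` (single-point smallness, any `u`);
* `not_royConditionA_zero_inv`, `not_royConditionB_zero_inv` (`|c| ≥ 2`): `(0, 1/c)` is off the
  graph of `exp` up to torsion, so by Roy's Theorem 1 condition (b) FAILS there;
* summary `roy_depth_at_one_point_is_blind`.

Reading (seat atlas §2-E5/§3-S2): in window (1) `s₀ + u < 1 + t₀ + t₁` (`royAdmissible_add_lt_one_add`,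
`Theorems/SoloInformedRoyWindow.lean`): `N^{s₀}` conditions at one point never exceed the capacity
`N^{t₀+t₁}` of the box, and this file realises that count with exact zeros (`2 s₀ < 1 + t₀ + t₁` is
what Siegel's exponent needs). So all the information of Roy's Conjecture 2 (`⟺` Schanuel,
`Roy2001_iff_holds`) sits in the TRANSLATES `(∑ mⱼyⱼ, ∏ αⱼ^{mⱼ})`, i.e. in the finitely generated
subgroup: a proof of Conjecture 2 must be a small-value estimate exploiting the group law, not a
deeper single-point criterion. Standard axioms only; built on the tree's `RoyCriterionProofs` API.

Sources: [Roy2001] D. Roy, *An arithmetic criterion for the values of the exponential function*,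
Acta Arith. 97 (2001), Thm. 1, Conj. 2, §5; [Waldschmidt2000] M. Waldschmidt, *Diophantine
approximation on linear algebraic groups*, Grundlehren 326, §4 (auxiliary functions, Siegel's lemma).
-/

noncomputable section

open MvPolynomial Filter Complex Metric Matrix
open Literature.NumberTheory.Transcendental

namespace Summit.Schanuel.Schanuel.Theorems

attribute [local instance] Matrix.seminormedAddCommGroup

/-! ### Roy's box and the single-point / translate conditions at level `N` (as sets of polynomials) -/

/-- Roy's box of auxiliary polynomials at level `N`: non-zero `Q ∈ ℤ[X₀, X₁]` with
`deg_{X₀} Q ≤ N^{t₀}`, `deg_{X₁} Q ≤ N^{t₁}` and height `H(Q) ≤ e^N`. [cite: Roy2001, Thm. 1 (b)] -/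
def royBox (t₀ t₁ : ℝ) (N : ℕ) : Set (MvPolynomial (Fin 2) ℤ) :=
  {Q | Q ≠ 0 ∧ (Q.degreeOf 0 : ℝ) ≤ (N : ℝ) ^ t₀ ∧ (Q.degreeOf 1 : ℝ) ≤ (N : ℝ) ^ t₁ ∧
    (mvPolyHeight Q : ℝ) ≤ Real.exp N}

/-- Polynomials with `|(D^k Q)(m y, α^m)| ≤ exp(-N^u)` for all `k ≤ N^{s₀}`, `m ≤ N^{s₁}` — the
evaluation part of Roy's condition (b) at level `N` (point AND translates). [cite: Roy2001, Thm. 1 (b)] -/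
def roySmallOnTranslates (y α : ℂ) (s₀ s₁ u : ℝ) (N : ℕ) : Set (MvPolynomial (Fin 2) ℤ) :=
  {Q | ∀ k m : ℕ, (k : ℝ) ≤ (N : ℝ) ^ s₀ → (m : ℝ) ≤ (N : ℝ) ^ s₁ →
    ‖aeval ![(m : ℂ) * y, α ^ m] (royD^[k] Q)‖ ≤ Real.exp (-(N : ℝ) ^ u)}

/-- Polynomials with `|(D^k Q)(y, α)| ≤ exp(-N^u)` for all `k ≤ N^{s₀}` — the SINGLE-POINT part
(`m = 1` only) of the evaluation condition. -/
def roySmallAt (y α : ℂ) (s₀ u : ℝ) (N : ℕ) : Set (MvPolynomial (Fin 2) ℤ) :=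
  {Q | ∀ k : ℕ, (k : ℝ) ≤ (N : ℝ) ^ s₀ → ‖aeval ![y, α] (royD^[k] Q)‖ ≤ Real.exp (-(N : ℝ) ^ u)}

/-- Polynomials with EXACT zeros `(D^k Q)(y, α) = 0` for all `k ≤ N^{s₀}` (no `u` at all). -/
def royVanishAt (y α : ℂ) (s₀ : ℝ) (N : ℕ) : Set (MvPolynomial (Fin 2) ℤ) :=
  {Q | ∀ k : ℕ, (k : ℝ) ≤ (N : ℝ) ^ s₀ → aeval ![y, α] (royD^[k] Q) = 0}

/-- Roy's condition (b) says: eventually the box meets the translate-smallness set. -/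
theorem royConditionB_iff (y α : ℂ) (s₀ s₁ t₀ t₁ u : ℝ) :
    RoyConditionB y α s₀ s₁ t₀ t₁ u ↔
      ∀ᶠ N : ℕ in atTop, (royBox t₀ t₁ N ∩ roySmallOnTranslates y α s₀ s₁ u N).Nonempty := by
  simp only [RoyConditionB, royBox, roySmallOnTranslates, Set.Nonempty, Set.mem_inter_iff,
    Set.mem_setOf_eq, and_assoc]

/-- Exact zeros at the point imply single-point smallness, for every `u`. -/
theorem royVanishAt_subset_roySmallAt (y α : ℂ) (s₀ u : ℝ) (N : ℕ) :
    royVanishAt y α s₀ N ⊆ roySmallAt y α s₀ u N := by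
  intro Q hQ k hk
  have h0 : aeval ![y, α] (royD^[k] Q) = 0 := hQ k hk
  rw [h0, norm_zero]
  exact (Real.exp_pos _).le

/-- Translate-smallness implies single-point smallness (take `m = 1`; needs `1 ≤ N^{s₁}`). -/
theorem roySmallOnTranslates_subset_roySmallAt (y α : ℂ) {s₀ s₁ u : ℝ} {N : ℕ}
    (hN : (1 : ℝ) ≤ (N : ℝ) ^ s₁) :
    roySmallOnTranslates y α s₀ s₁ u N ⊆ roySmallAt y α s₀ u N := by
  intro Q hQ k hk
  have := hQ k 1 hk (by simpa using hN)
  simpa using this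

/-- The single-point part of Roy's condition (b): if (b) holds then eventually the box meets the
single-point smallness set. [cite: Roy2001, Thm. 1 (b)] -/
theorem eventually_royBox_inter_roySmallAt_of_royConditionB {y α : ℂ} {s₀ s₁ t₀ t₁ u : ℝ}
    (hs₁ : 0 ≤ s₁) (h : RoyConditionB y α s₀ s₁ t₀ t₁ u) :
    ∀ᶠ N : ℕ in atTop, (royBox t₀ t₁ N ∩ roySmallAt y α s₀ u N).Nonempty := by
  rw [royConditionB_iff] at h
  filter_upwards [h, eventually_ge_atTop 1] with N hN hN1
  obtain ⟨Q, hQbox, hQsmall⟩ := hN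
  have h1 : (1 : ℝ) ≤ (N : ℝ) ^ s₁ := Real.one_le_rpow (by exact_mod_cast hN1) hs₁
  exact ⟨Q, hQbox, roySmallOnTranslates_subset_roySmallAt y α h1 hQsmall⟩

/-! ### The scaling `X₁ ↦ c X₁` commutes with Roy's derivation -/

/-- The substitution `σ_c : P(X₀, X₁) ↦ P(X₀, c X₁)` on `ℤ[X₀, X₁]`. [folklore] -/
def scaleX₁ (c : ℤ) : MvPolynomial (Fin 2) ℤ →ₐ[ℤ] MvPolynomial (Fin 2) ℤ :=
  bind₁ ![X 0, C c * X 1]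

/-- `σ_c X₀ = X₀`. [folklore] -/
@[simp] theorem scaleX₁_X_zero (c : ℤ) : scaleX₁ c (X 0) = X 0 := by simp [scaleX₁, bind₁_X_right]

/-- `σ_c X₁ = c X₁`. [folklore] -/
@[simp] theorem scaleX₁_X_one (c : ℤ) : scaleX₁ c (X 1) = C c * X 1 := by simp [scaleX₁, bind₁_X_right]

/-- `σ_c` fixes constants. [folklore] -/
@[simp] theorem scaleX₁_C (c a : ℤ) : scaleX₁ c (C a) = C a := by simp [scaleX₁]

/-- `D ∘ σ_c = σ_c ∘ D`: the derivation `∂/∂X₀ + X₁∂/∂X₁` is invariant under `X₁ ↦ c X₁`.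
[folklore] -/
theorem royD_scaleX₁ (c : ℤ) (P : MvPolynomial (Fin 2) ℤ) :
    royD (scaleX₁ c P) = scaleX₁ c (royD P) := by
  induction P using MvPolynomial.induction_on with
  | C a => rw [scaleX₁_C, royD_C, map_zero]
  | add p q hp hq => rw [map_add, royD_add, royD_add, map_add, hp, hq]
  | mul_X p i hp =>
    have key : ∀ j : Fin 2, j = 0 ∨ j = 1 := by decide
    rcases key i with rfl | rfl
    · simp only [map_mul, scaleX₁_X_zero, royD_mul, royD_X_zero, mul_one, map_add, hp]
    · simp only [map_mul, scaleX₁_X_one, royD_mul, royD_X_one, royD_C, zero_mul, zero_add,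
        map_add, hp]

/-- `D^k ∘ σ_c = σ_c ∘ D^k`. [folklore] -/
theorem iterate_royD_scaleX₁ (c : ℤ) (k : ℕ) (P : MvPolynomial (Fin 2) ℤ) :
    royD^[k] (scaleX₁ c P) = scaleX₁ c (royD^[k] P) := by
  induction k generalizing P with
  | zero => rfl
  | succ k ih =>
    rw [Function.iterate_succ_apply, royD_scaleX₁, ih, Function.iterate_succ_apply]

/-- `(σ_c P)(y, α) = P(y, c α)`. [folklore] -/
theorem aeval_scaleX₁ (c : ℤ) (P : MvPolynomial (Fin 2) ℤ) (y α : ℂ) :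
    aeval ![y, α] (scaleX₁ c P) = aeval ![y, (c : ℂ) * α] P := by
  have hg : (fun i => aeval ![y, α] (![X 0, C c * X 1] i)) = ![y, (c : ℂ) * α] := by
    funext i; fin_cases i <;> simp
  rw [scaleX₁, aeval_bind₁, hg]

/-- `σ_c (Σ t(a,b) X₀^a X₁^b) = Σ c^b t(a,b) X₀^a X₁^b`. [folklore] -/
theorem scaleX₁_polyOfCoeffs (c : ℤ) {T₀ T₁ : ℕ} (t : Fin (T₀ + 1) × Fin (T₁ + 1) → ℤ) :
    scaleX₁ c (polyOfCoeffs t) = polyOfCoeffs (fun ab => c ^ (ab.2 : ℕ) * t ab) := by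
  simp only [polyOfCoeffs, map_sum, map_mul, scaleX₁_C, monoXY, map_pow, scaleX₁_X_zero,
    scaleX₁_X_one]
  refine Finset.sum_congr rfl fun ab _ => ?_
  ring

/-- Evaluation of `D^k P` at `(0, 1)` is the Taylor-coefficient functional `taylorInt k P`. [folklore] -/
theorem aeval_zero_one_eq_taylorInt (k : ℕ) (P : MvPolynomial (Fin 2) ℤ) :
    aeval ![(0 : ℂ), 1] (royD^[k] P) = (taylorInt k P : ℂ) := by
  have hg : (fun i => (((![(0 : ℤ), 1] : Fin 2 → ℤ) i : ℤ) : ℂ)) = ![(0 : ℂ), 1] := by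
    funext i; fin_cases i <;> simp
  rw [taylorInt, intCast_eval, hg]

/-! ### Siegel's lemma: exact vanishing of many Taylor coefficients -/

/-- The Siegel step of `exists_royAuxPoly`, with its exact output kept: for admissible parameters
and large `N`, a non-zero coefficient vector `t` on the box `[0, N^{t₀}] × [0, N^{t₁}]` with
`‖t‖ ≤ e^N` such that the first `⌊N^λ⌋ + 1` Taylor coefficients of `polyOfCoeffs t (z, e^z)` at
`z = 0` vanish (`λ = royLambda t₀ t₁ u > u > s₀`).
[folklore: Thue–Siegel auxiliary polynomial; cf. Roy2001, Thm. 3] -/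
theorem exists_polyOfCoeffs_taylorInt_eq_zero {s₀ s₁ t₀ t₁ u : ℝ}
    (h : RoyAdmissible s₀ s₁ t₀ t₁ u) :
    ∀ᶠ N : ℕ in atTop,
      ∃ t : Fin (⌊(N : ℝ) ^ t₀⌋₊ + 1) × Fin (⌊(N : ℝ) ^ t₁⌋₊ + 1) → ℤ, t ≠ 0 ∧
        ‖t‖ ≤ Real.exp N ∧
        ∀ n : ℕ, n < ⌊(N : ℝ) ^ royLambda t₀ t₁ u⌋₊ + 1 → taylorInt n (polyOfCoeffs t) = 0 := by
  filter_upwards [eventually_aux_params h le_rfl, eventually_ge_atTop 1] with N hN hN1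
  set x : ℝ := (N : ℝ) with hxdef
  set T₀ : ℕ := ⌊x ^ t₀⌋₊ with hT₀def
  set T₁ : ℕ := ⌊x ^ t₁⌋₊ with hT₁def
  set L : ℕ := ⌊x ^ royLambda t₀ t₁ u⌋₊ + 1 with hLdef
  obtain ⟨hLM, hheight, -⟩ := hN
  have hL1 : 1 ≤ L := Nat.succ_le_succ (Nat.zero_le _)
  have hLM' : L < (T₀ + 1) * (T₁ + 1) := by omega
  -- Siegel's lemma
  obtain ⟨t, ht0, hAt, htnorm⟩ := Int.Matrix.exists_ne_zero_int_vec_norm_le (taylorMatrix L T₀ T₁)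
    (by simpa [Fintype.card_prod, Fintype.card_fin] using hLM') (by simp [Fintype.card_fin]; omega)
  simp only [Fintype.card_prod, Fintype.card_fin] at htnorm
  set M : ℝ := (((T₀ + 1) * (T₁ + 1) : ℕ) : ℝ) with hMset
  have hMpos : 0 < M := by rw [hMset]; positivity
  have hM1 : 1 ≤ M := by rw [hMset]; exact_mod_cast Nat.one_le_iff_ne_zero.2 (by positivity)
  have hLM_real : (L : ℝ) ≤ M := by rw [hMset]; exact_mod_cast hLM'.le
  have hnorm : ‖t‖ ≤ Real.exp N := by
    refine htnorm.trans ?_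
    set X : ℝ := M * max 1 ‖taylorMatrix L T₀ T₁‖ with hX
    have hX1 : 1 ≤ X := one_le_mul_of_one_le_of_one_le hM1 (le_max_left _ _)
    have hXpos : 0 < X := one_pos.trans_le hX1
    have he0 : 0 ≤ (L : ℝ) / (M - L) := div_nonneg (Nat.cast_nonneg _) (sub_nonneg.2 hLM_real)
    have hbnd : (1 : ℝ) ≤ (L : ℝ) ^ L * Real.exp T₁ :=
      one_le_mul_of_one_le_of_one_le (one_le_pow₀ (by exact_mod_cast hL1))
        (Real.one_le_exp (Nat.cast_nonneg _))
    have hlogX : Real.log X ≤ Real.log M + L * Real.log L + T₁ := by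
      have hmax : max 1 ‖taylorMatrix L T₀ T₁‖ ≤ (L : ℝ) ^ L * Real.exp T₁ :=
        max_le hbnd (norm_taylorMatrix_le L T₀ T₁ hL1)
      have hlm : Real.log (max 1 ‖taylorMatrix L T₀ T₁‖) ≤ L * Real.log L + T₁ := by
        calc Real.log (max 1 ‖taylorMatrix L T₀ T₁‖) ≤ Real.log ((L : ℝ) ^ L * Real.exp T₁) :=
              Real.log_le_log (lt_of_lt_of_le one_pos (le_max_left _ _)) hmax
          _ = L * Real.log L + T₁ := by
              rw [Real.log_mul (by positivity) (Real.exp_pos _).ne', Real.log_pow, Real.log_exp]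
      rw [hX, Real.log_mul hMpos.ne' (lt_of_lt_of_le one_pos (le_max_left _ _)).ne']
      linarith
    calc X ^ ((L : ℝ) / (M - L)) = Real.exp (Real.log X * ((L : ℝ) / (M - L))) :=
          Real.rpow_def_of_pos hXpos _
      _ ≤ Real.exp N := by
          refine Real.exp_le_exp.2 ?_
          calc Real.log X * ((L : ℝ) / (M - L)) = (L : ℝ) / (M - L) * Real.log X := mul_comm _ _
            _ ≤ (L : ℝ) / (M - L) * (Real.log M + L * Real.log L + T₁) :=
                mul_le_mul_of_nonneg_left hlogX he0
            _ ≤ N := hheight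
  refine ⟨t, ht0, hnorm, fun n hn => ?_⟩
  have h1 := congrFun hAt ⟨n, hn⟩
  rw [taylorMatrix_mulVec] at h1
  simpa using h1

/-! ### The main construction at `(y, α) = (0, 1/c)` -/

/-- Window facts used below: `0 < t₀`, `0 < t₁ < 1`, `0 < s₀ < λ` (`λ = royLambda t₀ t₁ u`).
[cite: Roy2001, §1 (1)] -/
theorem royAdmissible_window_facts {s₀ s₁ t₀ t₁ u : ℝ} (h : RoyAdmissible s₀ s₁ t₀ t₁ u) :
    0 < t₀ ∧ 0 < t₁ ∧ t₁ < 1 ∧ 0 < s₀ ∧ s₀ < royLambda t₀ t₁ u := by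
  obtain ⟨hs₀, hs₁, ht₀, ht₁, hu, h1, h2, h3⟩ := h
  have hmint₀ := lt_min_iff.1 (max_lt_iff.1 (max_lt_iff.1 h1).2).1
  have hs₀u : s₀ < u := lt_of_le_of_lt (le_max_left _ _) h2
  have hst : s₁ + t₁ < u := lt_of_le_of_lt (le_max_right _ _) h2
  refine ⟨ht₀, ht₁, ?_, hs₀, ?_⟩
  · linarith [hmint₀.2]
  · rw [royLambda]; linarith

/-- **Depth at one point is free (exact form).** For every integer `c ≠ 0` and every admissible
parameter choice, at `(y, α) = (0, 1/c)` there are, for all large `N`, non-zero `Q_N ∈ ℤ[X₀, X₁]`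
with `deg ≤ (N^{t₀}, N^{t₁})`, `H(Q_N) ≤ e^N` and `(D^k Q_N)(0, 1/c) = 0` for all `k ≤ N^{s₀}`
(`Q_N = P̃(X₀, c X₁)`, `P̃` the Siegel polynomial at level `⌊N/2⌋`; see the module docstring).
[folklore: Siegel-lemma auxiliary polynomial; cf. Roy2001, Thm. 1 and §5] -/
theorem eventually_royBox_inter_royVanishAt_zero_inv (c : ℤ) (hc : c ≠ 0) {s₀ s₁ t₀ t₁ u : ℝ}
    (h : RoyAdmissible s₀ s₁ t₀ t₁ u) :
    ∀ᶠ N : ℕ in atTop, (royBox t₀ t₁ N ∩ royVanishAt 0 ((c : ℂ)⁻¹) s₀ N).Nonempty := by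
  obtain ⟨ht₀, ht₁, ht₁1, hs₀, hs₀lam⟩ := royAdmissible_window_facts h
  set lam : ℝ := royLambda t₀ t₁ u with hlam
  have hlam0 : 0 < lam := hs₀.trans hs₀lam
  obtain ⟨N₀, hN₀⟩ := eventually_atTop.1 (exists_polyOfCoeffs_taylorInt_eq_zero h)
  set a : ℝ := |(c : ℝ)| with ha
  have ha1 : 1 ≤ a := by rw [ha, ← Int.cast_abs]; exact_mod_cast Int.one_le_abs hc
  have ha0 : 0 < a := one_pos.trans_le ha1
  have hloga : 0 ≤ Real.log a := Real.log_nonneg ha1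
  have q4 : (0 : ℝ) < (1 / 4 : ℝ) ^ lam := Real.rpow_pos_of_pos (by norm_num) _
  have H₁ : ∀ᶠ x : ℝ in atTop, Real.log a * x ^ t₁ ≤ 1 / 2 * x ^ (1 : ℝ) :=
    eventually_mul_rpow_le_mul_rpow (Real.log a) ht₁1 (by norm_num)
  have H₂ : ∀ᶠ x : ℝ in atTop, 1 * x ^ s₀ ≤ (1 / 4 : ℝ) ^ lam * x ^ lam :=
    eventually_mul_rpow_le_mul_rpow 1 hs₀lam q4
  filter_upwards [eventually_ge_atTop (2 * N₀ + 2), tendsto_natCast_atTop_atTop.eventually H₁,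
    tendsto_natCast_atTop_atTop.eventually H₂] with N hN E₁ E₂
  set N' : ℕ := N / 2 with hN'def
  have hN'₀ : N₀ ≤ N' := by omega
  have hN'le : (N' : ℝ) ≤ N := by exact_mod_cast Nat.div_le_self N 2
  have hN'half : (N' : ℝ) ≤ (N : ℝ) / 2 := Nat.cast_div_le
  have hN'quarter : (N : ℝ) / 4 ≤ N' := by
    have : (N : ℝ) ≤ 4 * (N' : ℝ) := by exact_mod_cast (show N ≤ 4 * N' by omega)
    linarith
  have hx0 : (0 : ℝ) ≤ (N : ℝ) := Nat.cast_nonneg _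
  have hx0' : (0 : ℝ) ≤ (N' : ℝ) := Nat.cast_nonneg _
  obtain ⟨t, ht0, htnorm, hvan⟩ := hN₀ N' hN'₀
  -- the scaled coefficient vector `t'(a,b) = c^b t(a,b)` (same box as `t`)
  set t' : Fin (⌊(N' : ℝ) ^ t₀⌋₊ + 1) × Fin (⌊(N' : ℝ) ^ t₁⌋₊ + 1) → ℤ :=
    fun ab => c ^ (ab.2 : ℕ) * t ab with ht'def
  have ht'0 : t' ≠ 0 := by
    intro h0
    apply ht0
    funext ab
    have h1 : c ^ (ab.2 : ℕ) * t ab = 0 := by simpa [ht'def] using congrFun h0 ab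
    rcases mul_eq_zero.1 h1 with h2 | h2
    · exact absurd h2 (pow_ne_zero _ hc)
    · simpa using h2
  have hT₁'le : ((⌊(N' : ℝ) ^ t₁⌋₊ : ℕ) : ℝ) ≤ (N : ℝ) ^ t₁ :=
    (Nat.floor_le (Real.rpow_nonneg hx0' _)).trans (Real.rpow_le_rpow hx0' hN'le ht₁.le)
  refine ⟨polyOfCoeffs t', ⟨polyOfCoeffs_ne_zero ht'0, ?_, ?_, ?_⟩, ?_⟩
  · calc ((polyOfCoeffs t').degreeOf 0 : ℝ) ≤ ((⌊(N' : ℝ) ^ t₀⌋₊ : ℕ) : ℝ) := by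
          exact_mod_cast degreeOf_polyOfCoeffs_fst t'
      _ ≤ (N' : ℝ) ^ t₀ := Nat.floor_le (Real.rpow_nonneg hx0' _)
      _ ≤ (N : ℝ) ^ t₀ := Real.rpow_le_rpow hx0' hN'le ht₀.le
  · calc ((polyOfCoeffs t').degreeOf 1 : ℝ) ≤ ((⌊(N' : ℝ) ^ t₁⌋₊ : ℕ) : ℝ) := by
          exact_mod_cast degreeOf_polyOfCoeffs_snd t'
      _ ≤ (N : ℝ) ^ t₁ := hT₁'le
  · -- height: `H(Q) ≤ ‖t'‖ ≤ |c|^{T₁'} ‖t‖ ≤ |c|^{T₁'} e^{N'} ≤ e^N`, `T₁' = ⌊N'^{t₁}⌋`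
    have hnorm' : ‖t'‖ ≤ a ^ ⌊(N' : ℝ) ^ t₁⌋₊ * ‖t‖ := by
      refine (pi_norm_le_iff_of_nonneg (by positivity)).2 fun ab => ?_
      have hb : (ab.2 : ℕ) ≤ ⌊(N' : ℝ) ^ t₁⌋₊ := Nat.lt_succ_iff.1 ab.2.isLt
      have h1 : a ^ (ab.2 : ℕ) ≤ a ^ ⌊(N' : ℝ) ^ t₁⌋₊ := pow_le_pow_right₀ ha1 hb
      have h2 : ‖t ab‖ ≤ ‖t‖ := norm_le_pi_norm t ab
      have h3 : ‖t' ab‖ = a ^ (ab.2 : ℕ) * ‖t ab‖ := by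
        simp only [ht'def, Int.norm_eq_abs, Int.cast_mul, Int.cast_pow, abs_mul, abs_pow, ha]
      rw [h3]
      exact mul_le_mul h1 h2 (norm_nonneg _) (by positivity)
    have hexp : a ^ ⌊(N' : ℝ) ^ t₁⌋₊ * Real.exp N' ≤ Real.exp N := by
      have e1 : a ^ ⌊(N' : ℝ) ^ t₁⌋₊ = Real.exp ((⌊(N' : ℝ) ^ t₁⌋₊ : ℝ) * Real.log a) := by
        rw [Real.exp_nat_mul, Real.exp_log ha0]
      rw [e1, ← Real.exp_add]
      refine Real.exp_le_exp.2 ?_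
      have h1 : ((⌊(N' : ℝ) ^ t₁⌋₊ : ℕ) : ℝ) * Real.log a ≤ (N : ℝ) ^ t₁ * Real.log a :=
        mul_le_mul_of_nonneg_right hT₁'le hloga
      have h2 : (N : ℝ) ^ t₁ * Real.log a ≤ 1 / 2 * (N : ℝ) := by
        rw [mul_comm]; simpa [Real.rpow_one] using E₁
      calc ((⌊(N' : ℝ) ^ t₁⌋₊ : ℕ) : ℝ) * Real.log a + (N' : ℝ)
          ≤ (N : ℝ) ^ t₁ * Real.log a + (N : ℝ) / 2 := add_le_add h1 hN'half
        _ ≤ 1 / 2 * (N : ℝ) + (N : ℝ) / 2 := add_le_add h2 le_rfl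
        _ = N := by ring
    calc (mvPolyHeight (polyOfCoeffs t') : ℝ) ≤ ‖t'‖ := mvPolyHeight_polyOfCoeffs_le t'
      _ ≤ a ^ ⌊(N' : ℝ) ^ t₁⌋₊ * ‖t‖ := hnorm'
      _ ≤ a ^ ⌊(N' : ℝ) ^ t₁⌋₊ * Real.exp N' := mul_le_mul_of_nonneg_left htnorm (by positivity)
      _ ≤ Real.exp N := hexp
  · -- exact vanishing: `(D^k Q)(0, 1/c) = (D^k P̃)(0, 1) = taylorInt k P̃ = 0` for `k ≤ N^{s₀} < L'`
    intro k hk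
    have hcC : (c : ℂ) ≠ 0 := by exact_mod_cast hc
    have hk' : k < ⌊(N' : ℝ) ^ lam⌋₊ + 1 := by
      have hkr : (k : ℝ) ≤ (N' : ℝ) ^ lam := by
        calc (k : ℝ) ≤ (N : ℝ) ^ s₀ := hk
          _ ≤ (1 / 4 : ℝ) ^ lam * (N : ℝ) ^ lam := by simpa using E₂
          _ = ((N : ℝ) / 4) ^ lam := by
              rw [show (N : ℝ) / 4 = (1 / 4 : ℝ) * N by ring, Real.mul_rpow (by norm_num) hx0]
          _ ≤ (N' : ℝ) ^ lam := Real.rpow_le_rpow (by positivity) hN'quarter hlam0.le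
      exact Nat.lt_succ_of_le (Nat.le_floor hkr)
    have hv := hvan k hk'
    rw [← scaleX₁_polyOfCoeffs, iterate_royD_scaleX₁, aeval_scaleX₁, mul_inv_cancel₀ hcC,
      aeval_zero_one_eq_taylorInt, hv, Int.cast_zero]

/-- **Depth at one point is free.** For every integer `c ≠ 0` and every admissible parameter choice,
eventually the box meets the single-point smallness set at `(0, 1/c)` (for the given `u`, indeed for any `u`).
[folklore; cf. Roy2001, Thm. 1] -/
theorem eventually_royBox_inter_roySmallAt_zero_inv (c : ℤ) (hc : c ≠ 0) {s₀ s₁ t₀ t₁ u : ℝ}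
    (h : RoyAdmissible s₀ s₁ t₀ t₁ u) :
    ∀ᶠ N : ℕ in atTop, (royBox t₀ t₁ N ∩ roySmallAt 0 ((c : ℂ)⁻¹) s₀ u N).Nonempty := by
  filter_upwards [eventually_royBox_inter_royVanishAt_zero_inv c hc h] with N hN
  exact hN.mono (Set.inter_subset_inter_right _ (royVanishAt_subset_roySmallAt _ _ _ _ _))

/-- `(0, 1/c)` with `|c| ≥ 2` is NOT on the graph of `exp` up to torsion: `(1/c)^d ≠ e^{d·0} = 1`.
[cite: Roy2001, Thm. 1 (a)] -/
theorem not_royConditionA_zero_inv (c : ℤ) (hc : 2 ≤ |c|) : ¬ RoyConditionA 0 ((c : ℂ)⁻¹) := by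
  rintro ⟨d, hd, h⟩
  have h1 : ‖((c : ℂ)⁻¹) ^ d‖ = 1 := by rw [h]; simp
  rw [norm_pow, norm_inv, Complex.norm_intCast] at h1
  have hc' : (2 : ℝ) ≤ |(c : ℝ)| := by
    rw [← Int.cast_abs]; exact_mod_cast hc
  have hlt : (|(c : ℝ)|)⁻¹ < 1 := inv_lt_one_of_one_lt₀ (by linarith)
  have hlt' : (|(c : ℝ)|)⁻¹ ^ d < 1 := pow_lt_one₀ (by positivity) hlt (by omega)
  linarith

/-- By Roy's Theorem 1 (`Roy2001_thm1_holds`), the full condition (b) FAILS at `(0, 1/c)`, `|c| ≥ 2`,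
for every admissible parameter choice. [cite: Roy2001, Thm. 1] -/
theorem not_royConditionB_zero_inv (c : ℤ) (hc : 2 ≤ |c|) {s₀ s₁ t₀ t₁ u : ℝ}
    (h : RoyAdmissible s₀ s₁ t₀ t₁ u) : ¬ RoyConditionB 0 ((c : ℂ)⁻¹) s₀ s₁ t₀ t₁ u := by
  have hc0 : c ≠ 0 := by
    intro h0; rw [h0, abs_zero] at hc; exact absurd hc (by norm_num)
  have hα : ((c : ℂ)⁻¹) ≠ 0 := inv_ne_zero (by exact_mod_cast hc0)
  intro hB
  exact not_royConditionA_zero_inv c hc ((Roy2001_thm1_holds 0 _ hα s₀ s₁ t₀ t₁ u h).2 hB)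

/-- **Summary: in Roy's criterion the depth at one point is blind; the translates carry everything.**
There is a point `(y, α) ∈ ℂ × ℂˣ` (namely `(0, 1/2)`), not on the graph of `exp` up to torsion,
at which for EVERY admissible `(s₀, s₁, t₀, t₁, u)`: eventually Roy's box contains polynomials with
exact zeros `(D^k Q_N)(y, α) = 0` for all `k ≤ N^{s₀}` (a fortiori the single-point part of condition
(b) holds), while condition (b) itself — the same smallness demanded also at the translates
`(m y, α^m)`, `m ≤ N^{s₁}` — fails (by Roy's Theorem 1, kernel-proved as `Roy2001_thm1_holds`).
Counting shadow: `s₀ + u < 1 + t₀ + t₁` always holds in window (1) (`royAdmissible_add_lt_one_add`),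
so single-point depth never exceeds the box capacity; only the translates do.
[folklore; cf. Roy2001, Thm. 1, Conj. 2] -/
theorem roy_depth_at_one_point_is_blind :
    ∃ y α : ℂ, α ≠ 0 ∧ ¬ RoyConditionA y α ∧
      ∀ s₀ s₁ t₀ t₁ u : ℝ, RoyAdmissible s₀ s₁ t₀ t₁ u →
        (∀ᶠ N : ℕ in atTop, (royBox t₀ t₁ N ∩ royVanishAt y α s₀ N).Nonempty) ∧
        (∀ᶠ N : ℕ in atTop, (royBox t₀ t₁ N ∩ roySmallAt y α s₀ u N).Nonempty) ∧
        ¬ (∀ᶠ N : ℕ in atTop, (royBox t₀ t₁ N ∩ roySmallOnTranslates y α s₀ s₁ u N).Nonempty) ∧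
        ¬ RoyConditionB y α s₀ s₁ t₀ t₁ u := by
  have h2 : (2 : ℤ) ≠ 0 := by norm_num
  have h2' : 2 ≤ |(2 : ℤ)| := by norm_num
  refine ⟨0, ((2 : ℤ) : ℂ)⁻¹, inv_ne_zero (by exact_mod_cast h2), not_royConditionA_zero_inv 2 h2',
    fun s₀ s₁ t₀ t₁ u h => ⟨eventually_royBox_inter_royVanishAt_zero_inv 2 h2 h,
      eventually_royBox_inter_roySmallAt_zero_inv 2 h2 h, ?_, not_royConditionB_zero_inv 2 h2' h⟩⟩
  rw [← royConditionB_iff]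
  exact not_royConditionB_zero_inv 2 h2' h

end Summit.Schanuel.Schanuel.Theorems

end
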